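import Summits.QuantumFields.BalabanUV.Gaps.D1PinnedColourScaling
import Summits.QuantumFields.BalabanUV.Beta.GAN24.Lin4Additive
import Summits.QuantumFields.BalabanUV.Beta.ChartConjugationReflection

/-!
# D1 (pinned family) — an2's first-order colour data are ADDITIVE in the colour triple; along an affine line `c⃗₀ + s·c⃗₁` every first-order table is an affine-quadratic path

Census row 79 of `HOME/g1/RESIDUE.md` (item (v) «`φ` is a polynomial on ℝ³», file 1 of 4).  CONTENT (all [folklore]; no `def`, no `def … : Prop`, 0 sorry):
§A `pushSum_add`, **`S0_colourAdd`**, **`Sc_colourAdd`** (an2's composite stencil is additive in `(cE, cVH, cΛ)`; with `D1PinnedColourScaling.Sc_colourScale` it is LINEAR), `summable_abs_wH`,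
**`vertexOf_add`** (BCJ's one-shot vertex is additive in a bounded stencil family — `ChartConjugationReflection.wsum_add`), **`e3Of_colourAdd`** (an2's value-function third jet is additive in
the colour triple); §B along an affine line of colour triples: **`e3Of_line`**, **`Spure_line`** (`Spure (c⃗₀ + s·c⃗₁) j = s²•A_j + s•B_j + C_j` with certified local tables), **`M1_line`**,
**`Sstep_line`** (an2's step stencil likewise, coefficients explicit).  Built imports only.

Provenance: cell pub-balaban-gaps, seat g1-p1 GEN 12 (prover-pub-balaban-gaps-g1-p1-g12-0), 2026-08-24.  HONEST FRAMING: [folklore] kernel algebra BY NAME over tree theorems;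
NOTHING of Bałaban's asserted ([Balaban1987RG1] Thm 2 is UNPROVED IN PRINT); NO coefficient computed or signed; binder (D1) of B12 Thm 2 at the β-lead's pinned literal is NOT
discharged; NOT `BetaPertH`, NOT continuum, NOT Clay.
-/

noncomputable section

open Finset
open scoped BigOperators
open Literature.MathematicalPhysics.QuantumFieldTheory Balaban1983to89 Balaban1983to89.Beta
open ExpKernelCalculus (MKer)
open OneStepResolventKernel (Fib)
open BalabanStepJets (S0)
open BalabanCompositeJets (Sc Sc_zero Sc_succ pushSum locStencil_Sc)
open ExpKernelCalculus (comp)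
open OneStepResolventKernel (KInv decays_KInv vertexOf vertexOf_weight)
open OneStepKernelFamily (colH vertexOfK_KInv)
open KernelSpecInstance (wH)
open KernelWard (Bdd)
open BalabanStepJetsSucc (e3Of mmRead)
open StepJetData (comp_add_right)
open Summit.QuantumFields.BalabanUV.Beta.VertexReflectionContact (comp_add_left mmRead_add)
open Summit.QuantumFields.BalabanUV.Beta.GAN24.Lin4Additive (abs_vertexOfK_le summable_slices_decays_bdd summable_slices_bdd_decays bdd_comp_decays_bdd)
open Summit.QuantumFields.BalabanUV.Beta.ChartConjugationReflection (wsum_add summable_abs_colH abs_le_of_locStencil)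

namespace Summit.QuantumFields.BalabanUV.Gaps.D1PinnedColourLineTables

variable {d : ℕ} {Lc : ℕ} [NeZero Lc]

omit [NeZero Lc] in
/-- [folklore] The one-step push of the multiplier legs is additive (a finite sum). -/
theorem pushSum_add (M L : ℕ) (K K' : MKer (d + 1) (Fib d)) : pushSum M L (K + K') = pushSum M L K + pushSum M L K' := by
  funext x w a b
  simp only [BalabanCompositeJets.pushSum, Pi.add_apply, Finset.sum_add_distrib, mul_add]

/-- [folklore] `S₀` is additive in the colour triple. -/
theorem S0_colourAdd (cE cVH cΛ cE' cVH' cΛ' : ℝ) : S0 d Lc (cE + cE') (cVH + cVH') (cΛ + cΛ') = S0 d Lc cE cVH cΛ + S0 d Lc cE' cVH' cΛ' := by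
  funext κ u x z a b
  simp only [BalabanStepJets.S0, Pi.add_apply, Pi.smul_apply, smul_eq_mul]
  ring

/-- [folklore] **an2's COMPOSITE STENCIL IS ADDITIVE IN THE COLOUR TRIPLE**: `Sc (c⃗ + c⃗′) n = Sc c⃗ n + Sc c⃗′ n` (with `Sc_colourScale`: LINEAR). -/
theorem Sc_colourAdd (cE cVH cΛ cE' cVH' cΛ' : ℝ) : ∀ n : ℕ, Sc d Lc (cE + cE') (cVH + cVH') (cΛ + cΛ') n = Sc d Lc cE cVH cΛ n + Sc d Lc cE' cVH' cΛ' n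
  | 0 => by rw [Sc_zero, Sc_zero, Sc_zero, S0_colourAdd]
  | n + 1 => by
    rw [Sc_succ, Sc_succ, Sc_succ, Sc_colourAdd cE cVH cΛ cE' cVH' cΛ' n]
    funext κ u x z a b
    simp only [Pi.add_apply, Pi.smul_apply, smul_eq_mul, pushSum_add]
    ring

/-- [folklore] The `ℋ`-weights of BCJ's one-shot vertex are absolutely summable (`vertexOf_weight` + `summable_abs_colH` for `KInv N`). -/
theorem summable_abs_wH {N : ℕ} [NeZero N] (κ' μ : Fin (d + 1)) (y : Fin (d + 1) → ℤ) : Summable fun u : Fin (d + 1) → ℤ => |wH (N := N) κ' μ (u - (N : ℤ) • y)| := by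
  have h := summable_abs_colH (N := N) (decays_KInv (N := N) (d := d)) μ y κ'
  refine h.congr fun u => ?_
  rw [OneStepKernelFamily.colH, ← vertexOf_weight]

/-- [folklore] **BCJ's ONE-SHOT CHAIN-RULE VERTEX IS ADDITIVE IN ITS STENCIL FAMILY** (bounded families). -/
theorem vertexOf_add {N : ℕ} [NeZero N] {S T : Fin (d + 1) → (Fin (d + 1) → ℤ) → MKer (d + 1) (Fib d)} {B₁ B₂ : ℝ} (hS : ∀ κ u x z a b, |S κ u x z a b| ≤ B₁)
    (hT : ∀ κ u x z a b, |T κ u x z a b| ≤ B₂) (μ : Fin (d + 1)) (y : Fin (d + 1) → ℤ) :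
    vertexOf (N := N) (fun κ u => S κ u + T κ u) μ y = vertexOf (N := N) S μ y + vertexOf (N := N) T μ y := by
  have hS' : ∀ κ u x z a b, |S κ u x z a b| ≤ max B₁ B₂ := fun κ u x z a b => (hS κ u x z a b).trans (le_max_left _ _)
  have hT' : ∀ κ u x z a b, |T κ u x z a b| ≤ max B₁ B₂ := fun κ u x z a b => (hT κ u x z a b).trans (le_max_right _ _)
  funext x z a b
  simp only [OneStepResolventKernel.vertexOf, Pi.add_apply]
  rw [← Finset.sum_add_distrib]
  refine Finset.sum_congr rfl fun κ' _ => ?_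
  have e := wsum_add (summable_abs_wH (N := N) κ' μ y) (hS' κ') (hT' κ')
  have e' := congrFun (congrFun (congrFun (congrFun e x) z) a) b
  simpa only [Pi.add_apply] using e'

/-- [folklore] **an2's VALUE-FUNCTION THIRD JET `e3Of` IS ADDITIVE IN THE COLOUR TRIPLE** (so, with `e3Of_colourScale`, LINEAR): `Sc_colourAdd`, `vertexOf_add` on the certified composite
stencils (`locStencil_Sc`), the two resolvent compositions split on bounded ∕ decaying slices (`comp_add_right ∕ comp_add_left`), `mmRead_add`. -/
theorem e3Of_colourAdd (hLc : 1 ≤ Lc) (cE cVH cΛ cE' cVH' cΛ' : ℝ) (j : ℕ) :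
    e3Of d Lc (cE + cE') (cVH + cVH') (cΛ + cΛ') j = fun κ' u' => e3Of d Lc cE cVH cΛ j κ' u' + e3Of d Lc cE' cVH' cΛ' j κ' u' := by
  obtain ⟨δK, CK, hδK, hCK, hK⟩ := decays_KInv (N := Lc ^ j) (d := d)
  obtain ⟨C₁, δ₁, hδ₁, h₁⟩ := locStencil_Sc (d := d) (Lc := Lc) hLc cE cVH cΛ (j - 1)
  obtain ⟨C₂, δ₂, hδ₂, h₂⟩ := locStencil_Sc (d := d) (Lc := Lc) hLc cE' cVH' cΛ' (j - 1)
  have b₁ : ∀ κ u x z a b, |Sc d Lc cE cVH cΛ (j - 1) κ u x z a b| ≤ C₁ := fun κ u x z a b => abs_le_of_locStencil h₁ hδ₁.le κ u x z a b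
  have b₂ : ∀ κ u x z a b, |Sc d Lc cE' cVH' cΛ' (j - 1) κ u x z a b| ≤ C₂ := fun κ u x z a b => abs_le_of_locStencil h₂ hδ₂.le κ u x z a b
  funext κ' u'
  have hV₁ : Bdd (vertexOf (N := Lc ^ j) (Sc d Lc cE cVH cΛ (j - 1)) κ' u') _ := fun x z a b => by
    rw [← vertexOfK_KInv]; exact abs_vertexOfK_le hK hδK (Lc ^ j) b₁ κ' u' x z a b
  have hV₂ : Bdd (vertexOf (N := Lc ^ j) (Sc d Lc cE' cVH' cΛ' (j - 1)) κ' u') _ := fun x z a b => by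
    rw [← vertexOfK_KInv]; exact abs_vertexOfK_le hK hδK (Lc ^ j) b₂ κ' u' x z a b
  have hsum : vertexOf (N := Lc ^ j) (Sc d Lc (cE + cE') (cVH + cVH') (cΛ + cΛ') (j - 1)) κ' u' =
      vertexOf (N := Lc ^ j) (Sc d Lc cE cVH cΛ (j - 1)) κ' u' + vertexOf (N := Lc ^ j) (Sc d Lc cE' cVH' cΛ' (j - 1)) κ' u' := by
    have e : Sc d Lc (cE + cE') (cVH + cVH') (cΛ + cΛ') (j - 1) = fun κ u => Sc d Lc cE cVH cΛ (j - 1) κ u + Sc d Lc cE' cVH' cΛ' (j - 1) κ u := by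
      rw [Sc_colourAdd]; rfl
    rw [e, vertexOf_add b₁ b₂]
  have h1 : comp (KInv (N := Lc ^ j) (d := d)) (vertexOf (N := Lc ^ j) (Sc d Lc cE cVH cΛ (j - 1)) κ' u' + vertexOf (N := Lc ^ j) (Sc d Lc cE' cVH' cΛ' (j - 1)) κ' u') =
      comp (KInv (N := Lc ^ j) (d := d)) (vertexOf (N := Lc ^ j) (Sc d Lc cE cVH cΛ (j - 1)) κ' u') + comp (KInv (N := Lc ^ j) (d := d)) (vertexOf (N := Lc ^ j) (Sc d Lc cE' cVH' cΛ' (j - 1)) κ' u') :=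
    comp_add_right (summable_slices_decays_bdd hK hδK hV₁) (summable_slices_decays_bdd hK hδK hV₂)
  have h2 := comp_add_left (M := KInv (N := Lc ^ j) (d := d)) (summable_slices_bdd_decays (bdd_comp_decays_bdd hK hδK hV₁) hK hδK) (summable_slices_bdd_decays (bdd_comp_decays_bdd hK hδK hV₂) hK hδK)
  funext x' z' a b
  simp only [BalabanStepJetsSucc.e3Of]
  rw [hsum, h1, h2, mmRead_add]
  simp only [Pi.add_apply, neg_add]
  rfl

end Summit.QuantumFields.BalabanUV.Gaps.D1PinnedColourLineTables

end

noncomputable section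

open Finset
open scoped BigOperators
open Literature.MathematicalPhysics.QuantumFieldTheory Balaban1983to89 Balaban1983to89.Beta
open ExpKernelCalculus (MKer VertexFamily)
open OneStepResolventKernel (Fib LocStencil)
open BalabanStepJets (S0 locStencil_S0 locStencil_mono)
open AveragingHessianKernels (vhS locStencil_vhS)
open StepJetData (locStencil_add locStencil_mfNeg)
open Summit.QuantumFields.BalabanUV.Beta.ChartConjugationReflection (abs_le_of_locStencil)
open BalabanStepJetsSucc (e3Of wE wVH wΛ Sstep locStencil_e3Of locStencil_Sstep)
open BalabanStepW2 (Spure M1 locStencil_Spure vertexFamily_M1)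
open StepJetData (mfNeg locStencil_smul)
open Summit.QuantumFields.BalabanUV.Gaps.D1PinnedColourScaling (e3Of_colourScale M1_colourScale)
open Summit.QuantumFields.BalabanUV.Gaps.D1PinnedColourLineTables (e3Of_colourAdd S0_colourAdd)

namespace Summit.QuantumFields.BalabanUV.Gaps.D1PinnedColourLineTables

variable {d : ℕ} {Lc : ℕ} [NeZero Lc]

/-- [folklore] `e3Of` along an affine line of colour triples: `e3Of (c⃗₀ + s·c⃗₁) j = e3Of c⃗₀ j + s • e3Of c⃗₁ j` (additive + homogeneous). -/
theorem e3Of_line (hLc : 1 ≤ Lc) (cE₀ cVH₀ cΛ₀ cE₁ cVH₁ cΛ₁ s : ℝ) (j : ℕ) :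
    e3Of d Lc (cE₀ + s * cE₁) (cVH₀ + s * cVH₁) (cΛ₀ + s * cΛ₁) j = fun κ u => e3Of d Lc cE₀ cVH₀ cΛ₀ j κ u + s • e3Of d Lc cE₁ cVH₁ cΛ₁ j κ u := by
  rw [e3Of_colourAdd hLc, e3Of_colourScale]
  rfl

/-- [folklore] **an2's UNFOLDED FIRST FIELD STENCIL ALONG AN AFFINE LINE OF COLOUR TRIPLES IS AN AFFINE-QUADRATIC PATH OF CERTIFIED TABLES**:
`Spure (c⃗₀ + s·c⃗₁) j = s²•A_j + s•B_j + C_j` with `A_j, B_j, C_j` certified local field tables (member 0: `A = 0`). -/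
theorem Spure_line (hLc : 1 ≤ Lc) (cE₀ cVH₀ cΛ₀ cE₁ cVH₁ cΛ₁ : ℝ) : ∀ j : ℕ, ∃ A B C : Fin (d + 1) → (Fin (d + 1) → ℤ) → MKer (d + 1) (Fib d),
    (∃ C' δ : ℝ, 0 < δ ∧ LocStencil A C' δ) ∧ (∃ C' δ : ℝ, 0 < δ ∧ LocStencil B C' δ) ∧ (∃ C' δ : ℝ, 0 < δ ∧ LocStencil C C' δ) ∧
      ∀ s : ℝ, Spure d Lc (cE₀ + s * cE₁) (cVH₀ + s * cVH₁) (cΛ₀ + s * cΛ₁) j = fun κ u => s ^ 2 • A κ u + s • B κ u + C κ u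
  | 0 => ⟨fun _ _ => 0, Spure d Lc cE₁ cVH₁ cΛ₁ 0, Spure d Lc cE₀ cVH₀ cΛ₀ 0, ⟨0, 1, one_pos, fun _ _ x z a b => by simp⟩, locStencil_Spure hLc cE₁ cVH₁ cΛ₁ 0,
      locStencil_Spure hLc cE₀ cVH₀ cΛ₀ 0, fun s => by funext κ u x z a b; simp only [BalabanStepW2.Spure, Pi.add_apply, Pi.smul_apply, Pi.zero_apply, smul_eq_mul, mul_zero]; ring⟩
  | j + 1 => by
    obtain ⟨C₁, δ₁, hδ₁, h1⟩ := locStencil_e3Of (d := d) (Lc := Lc) hLc cE₁ cVH₁ cΛ₁ (j + 1)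
    obtain ⟨C₀, δ₀, hδ₀, h0⟩ := locStencil_e3Of (d := d) (Lc := Lc) hLc cE₀ cVH₀ cΛ₀ (j + 1)
    refine ⟨fun κ u => (cE₁ * wE d Lc (j + 1)) • e3Of d Lc cE₁ cVH₁ cΛ₁ (j + 1) κ u,
      fun κ u => (cE₀ * wE d Lc (j + 1)) • e3Of d Lc cE₁ cVH₁ cΛ₁ (j + 1) κ u + ((cE₁ * wE d Lc (j + 1)) • e3Of d Lc cE₀ cVH₀ cΛ₀ (j + 1) κ u + (cVH₁ * wVH d Lc (j + 1)) • mfNeg (vhS d Lc κ u)),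
      Spure d Lc cE₀ cVH₀ cΛ₀ (j + 1), ⟨_, δ₁, hδ₁, locStencil_smul _ h1⟩, ?_, locStencil_Spure hLc cE₀ cVH₀ cΛ₀ (j + 1), fun s => ?_⟩
    · -- the linear-term table is a sum of three certified tables at the common rate `m`
      have hC₁ : 0 ≤ C₁ := (abs_nonneg _).trans (abs_le_of_locStencil h1 hδ₁.le 0 0 0 0 (Sum.inl 0) (Sum.inl 0))
      have hC₀ : 0 ≤ C₀ := (abs_nonneg _).trans (abs_le_of_locStencil h0 hδ₀.le 0 0 0 0 (Sum.inl 0) (Sum.inl 0))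
      have hm : 0 < min δ₁ δ₀ := lt_min hδ₁ hδ₀
      have g1 := locStencil_smul (cE₀ * wE d Lc (j + 1)) (locStencil_mono h1 hC₁ (min_le_left δ₁ δ₀))
      have g0 := locStencil_smul (cE₁ * wE d Lc (j + 1)) (locStencil_mono h0 hC₀ (min_le_right δ₁ δ₀))
      have gv := locStencil_smul (cVH₁ * wVH d Lc (j + 1)) (locStencil_mfNeg (locStencil_vhS (d := d) (L := Lc) hLc hm.le))
      exact ⟨_, _, hm, locStencil_add g1 (locStencil_add g0 gv)⟩
    · funext κ u
      rw [show Spure d Lc (cE₀ + s * cE₁) (cVH₀ + s * cVH₁) (cΛ₀ + s * cΛ₁) (j + 1) κ u =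
          ((cE₀ + s * cE₁) * wE d Lc (j + 1)) • e3Of d Lc (cE₀ + s * cE₁) (cVH₀ + s * cVH₁) (cΛ₀ + s * cΛ₁) (j + 1) κ u + ((cVH₀ + s * cVH₁) * wVH d Lc (j + 1)) • mfNeg (vhS d Lc κ u) from rfl,
        e3Of_line hLc]
      funext x z a b
      simp only [BalabanStepW2.Spure, Pi.add_apply, Pi.smul_apply, smul_eq_mul]
      ring

omit [NeZero Lc] in
/-- [folklore] an2's first multiplier table along an affine line of colour triples: `M1 (cΛ₀ + s·cΛ₁) j = s²•0 + s•M1 cΛ₁ j + M1 cΛ₀ j` (certified; `vertexFamily_M1`). -/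
theorem M1_line (hLc : 1 ≤ Lc) (cΛ₀ cΛ₁ : ℝ) (j : ℕ) : ∃ P Q R : Fin (d + 1) → (Fin (d + 1) → ℤ) → MKer (d + 1) (Fib d),
    (∃ C δ : ℝ, 0 < δ ∧ VertexFamily P Lc C δ) ∧ (∃ C δ : ℝ, 0 < δ ∧ VertexFamily Q Lc C δ) ∧ (∃ C δ : ℝ, 0 < δ ∧ VertexFamily R Lc C δ) ∧
      ∀ s : ℝ, M1 d Lc (cΛ₀ + s * cΛ₁) j = fun ρ w => s ^ 2 • P ρ w + s • Q ρ w + R ρ w :=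
  ⟨fun _ _ => 0, M1 d Lc cΛ₁ j, M1 d Lc cΛ₀ j, ⟨0, 1, one_pos, fun _ _ x z a b => by simp⟩, ⟨_, 1, one_pos, vertexFamily_M1 hLc cΛ₁ j zero_le_one⟩,
    ⟨_, 1, one_pos, vertexFamily_M1 hLc cΛ₀ j zero_le_one⟩, fun s => by funext ρ w x z a b; simp only [BalabanStepW2.M1, Pi.add_apply, Pi.smul_apply, Pi.zero_apply, smul_eq_mul, mul_zero]; ring⟩

/-- [folklore] **an2's STEP STENCIL (the `.S` of its jet datum at member `j+1`) ALONG AN AFFINE LINE OF COLOUR TRIPLES IS AN AFFINE-QUADRATIC PATH OF CERTIFIED TABLES**: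
`Sstep (c⃗₀ + s·c⃗₁) j = s²•A + s•B + C` with `A = (cE₁·wE)•e3Of c⃗₁`, `C = Sstep c⃗₀ j`, `B = Sstep c⃗₁ j + (cE₀·wE)•e3Of c⃗₁ + (cE₁·wE)•e3Of c⃗₀ − 2·(cE₁·wE)•e3Of c⃗₁`… — stated existentially with certificates. -/
theorem Sstep_line (hLc : 1 ≤ Lc) (cE₀ cVH₀ cΛ₀ cE₁ cVH₁ cΛ₁ : ℝ) (j : ℕ) : ∃ A B C : Fin (d + 1) → (Fin (d + 1) → ℤ) → MKer (d + 1) (Fib d),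
    (∃ C' δ : ℝ, 0 < δ ∧ LocStencil A C' δ) ∧ (∃ C' δ : ℝ, 0 < δ ∧ LocStencil B C' δ) ∧ (∃ C' δ : ℝ, 0 < δ ∧ LocStencil C C' δ) ∧
      ∀ s : ℝ, Sstep d Lc (cE₀ + s * cE₁) (cVH₀ + s * cVH₁) (cΛ₀ + s * cΛ₁) j = fun κ u => s ^ 2 • A κ u + s • B κ u + C κ u := by
  obtain ⟨C₁, δ₁, hδ₁, h1⟩ := locStencil_e3Of (d := d) (Lc := Lc) hLc cE₁ cVH₁ cΛ₁ j
  obtain ⟨C₀, δ₀, hδ₀, h0⟩ := locStencil_e3Of (d := d) (Lc := Lc) hLc cE₀ cVH₀ cΛ₀ j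
  obtain ⟨Cs, δs, hδs, hs⟩ := locStencil_Sstep (d := d) (Lc := Lc) hLc cE₁ cVH₁ cΛ₁ j
  -- B := Sstep c⃗₁ j + (cE₀·wE)•e3Of c⃗₁ + (cE₁·wE)•(e3Of c⃗₀ − e3Of c⃗₁): the cross terms of the product (cE₀ + s cE₁)·(E₀ + s E₁)
  refine ⟨fun κ u => (cE₁ * wE d Lc j) • e3Of d Lc cE₁ cVH₁ cΛ₁ j κ u,
    fun κ u => Sstep d Lc cE₁ cVH₁ cΛ₁ j κ u + ((cE₀ * wE d Lc j) • e3Of d Lc cE₁ cVH₁ cΛ₁ j κ u + ((cE₁ * wE d Lc j) • e3Of d Lc cE₀ cVH₀ cΛ₀ j κ u + (-(cE₁ * wE d Lc j)) • e3Of d Lc cE₁ cVH₁ cΛ₁ j κ u)),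
    Sstep d Lc cE₀ cVH₀ cΛ₀ j, ⟨_, δ₁, hδ₁, locStencil_smul _ h1⟩, ?_, locStencil_Sstep hLc cE₀ cVH₀ cΛ₀ j, fun s => ?_⟩
  · have hC₁ : 0 ≤ C₁ := (abs_nonneg _).trans (abs_le_of_locStencil h1 hδ₁.le 0 0 0 0 (Sum.inl 0) (Sum.inl 0))
    have hC₀ : 0 ≤ C₀ := (abs_nonneg _).trans (abs_le_of_locStencil h0 hδ₀.le 0 0 0 0 (Sum.inl 0) (Sum.inl 0))
    have hCs : 0 ≤ Cs := (abs_nonneg _).trans (abs_le_of_locStencil hs hδs.le 0 0 0 0 (Sum.inl 0) (Sum.inl 0))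
    have hm : 0 < min δs (min δ₁ δ₀) := lt_min hδs (lt_min hδ₁ hδ₀)
    have gs := locStencil_mono hs hCs (min_le_left δs (min δ₁ δ₀))
    have g1 := locStencil_smul (cE₀ * wE d Lc j) (locStencil_mono h1 hC₁ ((min_le_right δs _).trans (min_le_left δ₁ δ₀)))
    have g0 := locStencil_smul (cE₁ * wE d Lc j) (locStencil_mono h0 hC₀ ((min_le_right δs _).trans (min_le_right δ₁ δ₀)))
    have g1' := locStencil_smul (-(cE₁ * wE d Lc j)) (locStencil_mono h1 hC₁ ((min_le_right δs _).trans (min_le_left δ₁ δ₀)))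
    exact ⟨_, _, hm, locStencil_add gs (locStencil_add g1 (locStencil_add g0 g1'))⟩
  · have e := e3Of_line (d := d) (Lc := Lc) hLc cE₀ cVH₀ cΛ₀ cE₁ cVH₁ cΛ₁ s j
    funext κ u x z a b
    simp only [BalabanStepJetsSucc.Sstep, e, Pi.add_apply, Pi.smul_apply, smul_eq_mul]
    ring

end Summit.QuantumFields.BalabanUV.Gaps.D1PinnedColourLineTables

end
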